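import Literature.AlgebraicGeometry.Resolution.AffinePointBlowupAlgebra
import Literature.AlgebraicGeometry.Resolution.BlowupsIntegral
import Literature.AlgebraicGeometry.Resolution.BlowupsProperProofs
import Literature.AlgebraicGeometry.Resolution.BlowupLiftsCongruence
import Literature.AlgebraicGeometry.Resolution.VertexBlowupCharts
import HarnessLib

/-!
# Any blowing up of affine space `𝔸ⁿ⁺¹_K` at the origin is covered by `n + 1` affine spaces `𝔸ⁿ⁺¹_K`,
# with EXPLICIT chart maps `xᵢ ↦ yᵢ`, `xⱼ ↦ yᵢ·yⱼ` — EVERY `n`, EVERY field `K`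

Topic: `Literature/AlgebraicGeometry/Resolution`. Scheme-level library file (no named facts), part 2 of the
every-dimension form of `PlanePointBlowupAmbient.lean` / `PlanePointBlowupLocal.lean` (`n = 1`); part 1
(`AffinePointBlowupAlgebra.lean`) has `P = 𝔸ⁿ⁺¹_K = Spec K[x₀, …, x_n]`, the origin `ξ`, its reduced ideal sheaf `𝓘`,
the substitution `substHom i` (`xᵢ ↦ xᵢ`, `xⱼ ↦ xᵢ·xⱼ`) and `chartRingEquiv i : K[x] ≅ K[x][I/xᵢ]`. For ANY blowing up
`π : W → P` of `𝓘` in the sense of the universal property (`IsBlowup`, `Blowups.lean`) and every `i`: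

* `AffinePointBlowup.chart π i = W[⊤, xᵢ]` (the tree's principal chart), affine, **`⨆ᵢ W[⊤, xᵢ] = W`** (`iSup_chart`);
* **`AffinePointBlowup.chartImm hπ i : P ⟶ W`** — an OPEN IMMERSION of `𝔸ⁿ⁺¹_K` onto `W[⊤, xᵢ]`
  (`opensRange_chartImm`; Stacks 0804, transported by `IsBlowup.exists_chart_of_ringEquiv` of
  `VertexBlowupCharts.lean`) with **`chartImm hπ i ≫ π = Spec (substHom n K i)`** (`chartImm_comp`) and hence
  `chartImm hπ i ≫ π ≫ f = f` over `Spec K` (`chartImm_comp_f`);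
* `AffinePointBlowup.chartCover hπ : W.OpenCover` — **the `n + 1` charts cover `W`** (`iSup_opensRange_chartImm`);
* `AffinePointBlowup.smooth_comp` — **`W → Spec K` is SMOOTH** (every field `K`), `locallyOfFiniteType_comp`,
  `quasiCompact_comp` (integrality / irreducibility / properness are the generic `IsBlowup.isIntegral (𝓘_ne_bot n K)`,
  `IsBlowup.irreducibleSpace (𝓘_ne_bot n K)`, `IsBlowup.isProper` — not restated);
* `AffinePointBlowup.ξ' hπ i`, `π_ξ'` — the origin of the `i`-th chart lies over `ξ`;
* `AffinePointBlowup.exists_chartEquiv` — the sections form: `Γ(W, W[⊤, xᵢ]) ≅ K[x]` with `π^* s ↦ substHom i (γ s)`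
  (the shape of `PlanePointBlowupAmbient.exists_chartEquiv`).

These are the standard charts `Bl_0 𝔸ⁿ⁺¹ = ⋃ᵢ Spec K[xᵢ, xⱼ/xᵢ]` (Hartshorne I §4 p. 29 / II Ex. 7.12; Eisenbud–Harris
§9.3.2; Görtz–Wedhorn I (13.19), Example 13.95), for an ARBITRARY blowing up (not a chosen model), every `n`, every `K`.

## Sources

* The Stacks Project, Tag 0804 (the blowing up is covered by the `Spec A[I/a]`), Tag 0BIQ, Tag 02ND, Tag 02NS. [StacksProject]
* U. Görtz, T. Wedhorn, *Algebraic Geometry I*, 2nd ed. (2020), (13.19), Example 13.95. [GortzWedhorn2020]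
* D. Eisenbud, J. Harris, *3264 and All That* (2016), §9.3.2. [EisenbudHarris2016]
* A. Grothendieck, EGA IV₄ (1967), Prop. 17.5.8 (iii) (smoothness is local; polynomial algebras are smooth). [Grothendieck1967]
-/

noncomputable section

open CategoryTheory AlgebraicGeometry TopologicalSpace Opposite MvPolynomial
open Scheme.IdealSheafData

namespace Literature.AlgebraicGeometry.Resolution

namespace AffinePointBlowup

universe u

variable {n : ℕ} {K : Type u} [Field K]

/-! ## The charts of a blowing up of `𝔸ⁿ⁺¹` at the origin -/

section Blowup

variable {W : Scheme.{u}} (π : W ⟶ P n K)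

/-- **The chart `W[⊤, xᵢ]`** of a morphism `π : W → P` (the tree's principal chart of `π` for `(⊤, xᵢ)`).
[cite: StacksProject, Tag 0804] -/
def chart (i : Fin (n + 1)) : W.Opens := blowupChart π (𝓘 n K) (Wtop n K) (coord n K i)

/-- `W[⊤, xᵢ] ≤ π⁻¹(⊤)`. [cite: StacksProject, Tag 0804] -/
theorem chart_le (i : Fin (n + 1)) : chart π i ≤ π ⁻¹ᵁ ((Wtop n K) : (P n K).Opens) :=
  blowupChart_le_preimage π (𝓘 n K) (Wtop n K) (coord n K i)

variable {π} (hπ : IsBlowup π (𝓘 n K))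
include hπ

/-- The charts of a blowing up are affine. [cite: StacksProject, Tag 0804] -/
theorem isAffineOpen_chart (i : Fin (n + 1)) : IsAffineOpen (chart π i) :=
  hπ.isAffineOpen_blowupChart (coord_mem n K i)

/-- **The `n + 1` charts cover the blow-up.** [cite: StacksProject, Tag 0804] -/
theorem iSup_chart : ⨆ i, chart π i = ⊤ := by
  have h := hπ.iSup_blowupChart (coord n K) (ideal_𝓘_top n K).symm
  change ⨆ i, blowupChart π (𝓘 n K) (Wtop n K) (coord n K i) = ⊤
  rw [h]
  exact π.preimage_top

/-- The raw `i`-th chart `Spec K[x][I/xᵢ] → W` (Stacks 0804, transported along `γ : Γ(P, ⊤) ≅ K[x]`).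
[cite: StacksProject, Tag 0804] -/
theorem exists_rawChart (i : Fin (n + 1)) :
    ∃ (c : Spec (.of (PointBlowup.Chart n K i)) ⟶ W) (_ : IsOpenImmersion c),
      c.opensRange = chart π i ∧
        c ≫ π = Spec.map (CommRingCat.ofHom ((algebraMap (A n K) (PointBlowup.Chart n K i)).comp
          (γ n K).toRingHom)) ≫ (Wtop n K).2.fromSpec :=
  hπ.exists_chart_of_ringEquiv (Wtop n K) (coord_mem n K i) (γ n K) (PointBlowup.originIdeal n K) (X i)
    (map_ideal_𝓘_top n K) (γ_coord n K i)

/-- **The `i`-th chart `chartImm hπ i : 𝔸ⁿ⁺¹_K ⟶ W`** of a blowing up of `𝔸ⁿ⁺¹_K` at the origin. [cite: StacksProject, Tag 0804] -/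
def chartImm (i : Fin (n + 1)) : P n K ⟶ W :=
  Spec.map (chartRingEquiv n K i).symm.toCommRingCatIso.hom ≫ (exists_rawChart hπ i).choose

/-- The chart is an open immersion. [cite: StacksProject, Tag 0804] -/
instance isOpenImmersion_chartImm (i : Fin (n + 1)) : IsOpenImmersion (chartImm hπ i) := by
  haveI := (exists_rawChart hπ i).choose_spec.choose
  exact inferInstanceAs
    (IsOpenImmersion (Spec.map (chartRingEquiv n K i).symm.toCommRingCatIso.hom ≫ (exists_rawChart hπ i).choose))

/-- **The image of the `i`-th chart is the principal chart `W[⊤, xᵢ]`.** [cite: StacksProject, Tag 0804] -/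
theorem opensRange_chartImm (i : Fin (n + 1)) : (chartImm hπ i).opensRange = chart π i := by
  haveI := (exists_rawChart hπ i).choose_spec.choose
  change (Spec.map (chartRingEquiv n K i).symm.toCommRingCatIso.hom ≫ (exists_rawChart hπ i).choose).opensRange = _
  rw [Scheme.Hom.opensRange_comp_of_isIso]
  exact (exists_rawChart hπ i).choose_spec.choose_spec.1

/-- **The chart map in coordinates: `chartImm hπ i ≫ π = Spec (substHom i)`**, i.e. `π` is `xᵢ ↦ yᵢ`,
`xⱼ ↦ yᵢ·yⱼ` on the `i`-th chart. [cite: EisenbudHarris2016, §9.3.2] -/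
theorem chartImm_comp (i : Fin (n + 1)) :
    chartImm hπ i ≫ π = Spec.map (CommRingCat.ofHom (substHom n K i).toRingHom) := by
  change (Spec.map (chartRingEquiv n K i).symm.toCommRingCatIso.hom ≫ (exists_rawChart hπ i).choose) ≫ π = _
  rw [Category.assoc, (exists_rawChart hπ i).choose_spec.choose_spec.2, specMap_comp_γ_fromSpec,
    ← Spec.map_comp]
  congr 1
  apply CommRingCat.hom_ext
  refine RingHom.ext fun a => ?_
  change (chartRingEquiv n K i).symm (algebraMap (A n K) (PointBlowup.Chart n K i) a) = substHom n K i a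
  exact chartRingEquiv_symm_algebraMap n K i a

/-- **Over `Spec K` the chart is the identity of `𝔸ⁿ⁺¹_K`:** `chartImm hπ i ≫ π ≫ f = f`. [cite: EisenbudHarris2016, §9.3.2] -/
theorem chartImm_comp_f (i : Fin (n + 1)) : chartImm hπ i ≫ π ≫ f n K = f n K := by
  rw [← Category.assoc, chartImm_comp, f, ← Spec.map_comp]
  congr 1
  apply CommRingCat.hom_ext
  refine RingHom.ext fun c => ?_
  change substHom n K i (algebraMap K (A n K) c) = algebraMap K (A n K) c
  exact (substHom n K i).commutes c

/-- The images of the charts cover `W`. [cite: StacksProject, Tag 0804] -/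
theorem iSup_opensRange_chartImm : ⨆ i, (chartImm hπ i).opensRange = ⊤ := by
  simp_rw [opensRange_chartImm]
  exact iSup_chart hπ

/-- **The open cover of `W` by `n + 1` affine spaces `𝔸ⁿ⁺¹_K`.** [cite: StacksProject, Tag 0804] -/
def chartCover : Scheme.OpenCover.{0} W :=
  Scheme.Cover.mkOfCovers (Fin (n + 1)) (fun _ => P n K) (chartImm hπ) fun w => by
    have hw : w ∈ (⊤ : W.Opens) := trivial
    rw [← iSup_opensRange_chartImm hπ, Opens.mem_iSup] at hw
    obtain ⟨i, y, hy⟩ := hw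
    exact ⟨i, y, hy⟩

/-- **The blow-up of `𝔸ⁿ⁺¹_K` at the origin is SMOOTH over `K` — every field `K`.**
[cite: Grothendieck1967, Prop. 17.5.8 (iii) (PDF p. 69)] -/
theorem smooth_comp : Smooth (π ≫ f n K) :=
  (IsZariskiLocalAtSource.iff_of_openCover (P := @Smooth) (chartCover hπ)).mpr fun i => by
    change Smooth (chartImm hπ i ≫ π ≫ f n K)
    rw [chartImm_comp_f]
    exact smooth_f n K

/-- `W → Spec K` is quasi-compact. [cite: StacksProject, Tag 02NS] -/
theorem quasiCompact_comp : QuasiCompact (π ≫ f n K) := by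
  haveI : IsProper π := hπ.isProper
  infer_instance

/-- `W → Spec K` is locally of finite type. [cite: StacksProject, Tag 02NS] -/
theorem locallyOfFiniteType_comp : LocallyOfFiniteType (π ≫ f n K) := by
  haveI := smooth_comp hπ
  infer_instance

/-- The origin `ξ′ᵢ` of the `i`-th chart, a point of `W`. [cite: EisenbudHarris2016, §9.3.2] -/
def ξ' (i : Fin (n + 1)) : W := chartImm hπ i (ξ n K)

/-- `ξ′ᵢ` lies in the `i`-th chart. [cite: StacksProject, Tag 0804] -/
theorem ξ'_mem (i : Fin (n + 1)) : ξ' hπ i ∈ chart π i := by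
  rw [← opensRange_chartImm hπ i]
  exact ⟨ξ n K, rfl⟩

/-- **The chart origins lie over the origin: `π ξ′ᵢ = ξ`.** [cite: EisenbudHarris2016, §9.3.2] -/
theorem π_ξ' (i : Fin (n + 1)) : π (ξ' hπ i) = ξ n K := by
  change π (chartImm hπ i (ξ n K)) = ξ n K
  rw [← Scheme.Hom.comp_apply, chartImm_comp]
  exact specMap_substHom_ξ n K i

omit hπ in
/-- Transport helper (dependent types): a sections isomorphism `Γ(W, W[⊤, xᵢ]) ≅ K[x][J/a]` for any `(J, a)`
equal to `(γ 𝓘(⊤), γ xᵢ)`. [cite: StacksProject, Tag 0804] -/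
theorem exists_chartEquiv_aux (hπ : IsBlowup π (𝓘 n K)) (i : Fin (n + 1)) (J : Ideal (A n K)) (a : A n K)
    (hJ : ((𝓘 n K).ideal (Wtop n K)).map (γ n K).toRingHom = J) (ha : γ n K (coord n K i) = a) :
    ∃ Φ : Γ(W, chart π i) ≃+* blowupAlgebra J a,
      ∀ s, Φ ((π.appLE (Wtop n K) (chart π i) (chart_le π i)).hom s) =
        algebraMap (A n K) (blowupAlgebra J a) (γ n K s) := by
  subst hJ
  subst ha
  obtain ⟨e, he⟩ := hπ.exists_ringEquiv_blowupChart (Wtop n K) (coord_mem n K i)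
  refine ⟨e.trans (blowupAlgebra.congrEquiv (γ n K) ((𝓘 n K).ideal (Wtop n K)) (coord n K i)), fun s => ?_⟩
  exact (congrArg (blowupAlgebra.congrEquiv (γ n K) ((𝓘 n K).ideal (Wtop n K)) (coord n K i)) (he s)).trans
    (blowupAlgebra.congrEquiv_algebraMap (γ n K) _ _ s)

/-- **Each chart is an affine space, in sections**: `Γ(W, W[⊤, xᵢ]) ≅ K[x₀, …, x_n]` with `π^* s ↦ substHom i (γ s)`
(the form of `PlanePointBlowupAmbient.exists_chartEquiv`). [cite: StacksProject, Tag 0BIQ] -/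
theorem exists_chartEquiv (i : Fin (n + 1)) :
    ∃ Φ : Γ(W, chart π i) ≃+* A n K,
      ∀ s, Φ ((π.appLE (Wtop n K) (chart π i) (chart_le π i)).hom s) = substHom n K i (γ n K s) := by
  obtain ⟨Φ₀, hΦ₀⟩ := exists_chartEquiv_aux hπ i (PointBlowup.originIdeal n K) (X i) (map_ideal_𝓘_top n K)
    (γ_coord n K i)
  refine ⟨Φ₀.trans (chartRingEquiv n K i).symm, fun s => ?_⟩
  exact (congrArg (chartRingEquiv n K i).symm (hΦ₀ s)).trans (chartRingEquiv_symm_algebraMap n K i _)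

end Blowup

end AffinePointBlowup

end Literature.AlgebraicGeometry.Resolution

end
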